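import Summits.AtomisticToContinuum.Crystallization.Theorems.ChargedEnergyGapResidualSF
import HarnessLib

/-!
# Charged energy gap — lens-3 g64, node «BarlowRef» (R3) — part 11 (independent): FINITE ABEL SUMMATION with cumulative count bounds

Imports only the tree (`…ResidualSF`).  ELEMENTARY·PROVED.  The bookkeeping step every certified sum of the P-Z₅c′ numerator uses (memo g64 §3
«CERTIFIED-CONSTANT MODEL», HANDOFF g65 item 2 (F)): a sum `Σ_{x ∈ T} f(g x)` of an ANTITONE non-negative profile `f` of a "distance" `g x ≥ t₀` is
bounded through CUMULATIVE count bounds `#{x ∈ T | g x < t_{k+1}} ≤ N_{k+1}` on a monotone grid `t₀ ≤ t₁ ≤ … ≤ t_m` and a total count `#T ≤ N_T`: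
`Σ_{x ∈ T} f(g x) ≤ f(t_m) · N_T + Σ_{k < m} (f(t_k) − f(t_{k+1})) · N_{k+1}`.
Instances: targets per source (`g = dist · y` from `t₀ = 60` with annulus counts, or `g = dist · c` behind the sharp shadow), sources per member
(`g = dist · c` from `t₀ = ϱ − ℓ` with cored counts), weights `f = (·)⁻⁶`-type profiles (part 10 supplies the sharp ones).

* `le_abel_pointwise` — the pointwise layer-cake inequality `f u ≤ f(t_m) + Σ_{k<m} [u < t_{k+1}] (f(t_k) − f(t_{k+1}))` for `u ≥ t₀`;
* ★ `sum_antitone_le_abel` — the summed form above.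

0 sorry; standard axioms.
-/

noncomputable section

open scoped Classical

namespace Summit.AtomisticToContinuum.Crystallization.Theorems.ChargedEnergyGapChartDial

section AbelSum

variable {α : Type*}

/-- POINTWISE LAYER CAKE: for `f` antitone on `[t 0, ∞)`, a monotone grid `t` and `u ≥ t 0`,
`f u ≤ f (t m) + Σ_{k < m} [u < t (k+1)] · (f (t k) − f (t (k+1)))`. -/
theorem le_abel_pointwise (f : ℝ → ℝ) (t : ℕ → ℝ) (hf : ∀ a b, t 0 ≤ a → a ≤ b → f b ≤ f a) (ht : Monotone t) :
    ∀ (m : ℕ) (u : ℝ), t 0 ≤ u →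
      f u ≤ f (t m) + ∑ k ∈ Finset.range m, (if u < t (k + 1) then f (t k) - f (t (k + 1)) else 0) := by
  intro m
  induction m with
  | zero => intro u hu; simpa using hf (t 0) u le_rfl hu
  | succ m ih =>
      intro u hu
      rw [Finset.sum_range_succ]
      by_cases hlt : u < t (m + 1)
      · rw [if_pos hlt]
        have := ih u hu
        linarith
      · rw [if_neg hlt]
        have hge : t (m + 1) ≤ u := not_lt.mp hlt
        have hzero : ∑ k ∈ Finset.range m, (if u < t (k + 1) then f (t k) - f (t (k + 1)) else 0) = 0 := by
          refine Finset.sum_eq_zero fun k hk => ?_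
          rw [Finset.mem_range] at hk
          have : t (k + 1) ≤ u := (ht (by omega)).trans hge
          rw [if_neg (not_lt.mpr this)]
        rw [hzero]
        have := hf (t (m + 1)) u (ht (Nat.zero_le _)) hge
        linarith

/-- ★ **FINITE ABEL SUMMATION WITH CUMULATIVE COUNT BOUNDS.**  `f` antitone on `[t 0, ∞)` with `0 ≤ f (t m)`, `t` monotone, every `g x ≥ t 0`
(`x ∈ T`), cumulative counts `#{x ∈ T | g x < t (k+1)} ≤ N (k+1)` for `k < m` and `#T ≤ N_T` ⟹
`Σ_{x ∈ T} f (g x) ≤ f (t m) · N_T + Σ_{k < m} (f (t k) − f (t (k+1))) · N (k+1)`. -/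
theorem sum_antitone_le_abel (T : Finset α) (g : α → ℝ) (f : ℝ → ℝ) (t N : ℕ → ℝ) (m : ℕ) {NT : ℝ}
    (hf : ∀ a b, t 0 ≤ a → a ≤ b → f b ≤ f a) (hf0 : 0 ≤ f (t m)) (ht : Monotone t) (hg : ∀ x ∈ T, t 0 ≤ g x)
    (hN : ∀ k < m, ((T.filter fun x => g x < t (k + 1)).card : ℝ) ≤ N (k + 1)) (hNT : (T.card : ℝ) ≤ NT) :
    ∑ x ∈ T, f (g x) ≤ f (t m) * NT + ∑ k ∈ Finset.range m, (f (t k) - f (t (k + 1))) * N (k + 1) := by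
  have hdiff : ∀ k, 0 ≤ f (t k) - f (t (k + 1)) := fun k =>
    sub_nonneg.mpr (hf _ _ (ht (Nat.zero_le k)) (ht (Nat.le_succ k)))
  calc ∑ x ∈ T, f (g x)
      ≤ ∑ x ∈ T, (f (t m) + ∑ k ∈ Finset.range m, (if g x < t (k + 1) then f (t k) - f (t (k + 1)) else 0)) :=
        Finset.sum_le_sum fun x hx => le_abel_pointwise f t hf ht m (g x) (hg x hx)
    _ = f (t m) * T.card + ∑ k ∈ Finset.range m, (f (t k) - f (t (k + 1))) * ((T.filter fun x => g x < t (k + 1)).card : ℝ) := by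
        rw [Finset.sum_add_distrib, Finset.sum_const, nsmul_eq_mul, mul_comm, Finset.sum_comm]
        congr 1
        refine Finset.sum_congr rfl fun k _ => ?_
        rw [← Finset.sum_filter, Finset.sum_const, nsmul_eq_mul, mul_comm]
    _ ≤ f (t m) * NT + ∑ k ∈ Finset.range m, (f (t k) - f (t (k + 1))) * N (k + 1) := by
        gcongr with k hk
        · exact hdiff k
        · exact hN k (Finset.mem_range.mp hk)

end AbelSum

end Summit.AtomisticToContinuum.Crystallization.Theorems.ChargedEnergyGapChartDial
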